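/-
Copyright: the b2b-balaban cell (near-miss cell 7), T⁴-continuum fan-out, lineage t4-ne7b-p1 (node U5c COUNT member).
Released under the licence of the surrounding project.
-/
import Summits.QuantumFields.BalabanUV.T4Continuum.Support.ZoneTorusCrowd

/-!
# Zone extent law: the AFFINE CONTRACTION LAW of the zone chain from elementary zone dynamics

Summits-side support leaf of the T⁴-continuum cell (rung (B)+1 on a FINITE torus only; NOT infinite volume, NOT the
mass gap, NOT the Clay statement; NOT a proof of the spine estimate NE7b).  Lineage `t4-ne7b-p1` (generation 20),
node U5c, wall (GM), located item G-ne7bp1g18-2.  [folklore] elementary real analysis over the lineage's OWN carrier;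
nothing is quoted from print and nothing printed is asserted; no `[cite:]` tag.

WHY.  After `Support/ZoneTorus{,Crowd}.lean` the (GM) side of the count chain displays, besides the reading (ID) and the
chronology, ONE analytic-looking input: the affine contraction law `ext t X ≤ C₀·qZ wt σ st X t + c₀` of the extents
(radii within which merger partners' root blocks are `near`).  This leaf derives that law from FOUR ELEMENTARY
DYNAMICAL FACTS about zone extents (`ZoneDyn`): (birth) a new structure's extent at its formation step is at most
`Cb·wt b` (class-`d′` regions span `≲ d′+1` blocks); (merge) at a merger the merged extent is at most the partners'
extents plus `1` (touching zones); (step) one blocking step contracts an extent: `ext (t+1) X ≤ σ²·ext t X + 1`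
(division by `L = σ⁻²` up to rounding); (renew) a renewal does not enlarge the extent.  Then (`ext_le_affine`) every
WELL-FORMED CHRONOLOGICAL structure obeys, from its formation time on,
`ext t X ≤ C₀·qZ wt σ st X t + c₀` with `c₀ = 1∕(1−σ²)` and any `C₀ ≥ max(Cb, c₀+1)` (weights `≥ 1` absorb the
merger's `2c₀+1`; the geometric series absorbs the rounding).  The law for ALL `t, X` (the displayed binder's shape) holds
for the GUARDED extent `guardExt` (the extent where the structure is well-formed, chronological and already formed, `0`
elsewhere), and zone admissibility of a well-formed chronological genealogy reads the guarded and the unguarded extents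
identically (`admZ_guard_gmap_iff`).  §4 plugs this into `ZoneTorus.card_admZSet_grestrict_le`:
**`card_admZSet_grestrict_le_of_dyn`** — the `hlabZ` multiplicity factor on the torus with the affine law REPLACED by
`ZoneDyn PEv.step wtPEv σ Cb ext` + `ext ≥ 0`.

WHAT REMAINS DISPLAYED on the (GM) side after this leaf: the four `ZoneDyn` inequalities for the reading's extent
function on `Gen PEv` (elementary geometry of the torus blocks once the reading says which cells a structure's zone
occupies), `ext ≥ 0`, `Chrono`, the kinds, and the reading (ID) (G-ne7bp1g9-1); (E2)∕(R1) (G-ne7bp1-1) untouched.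

HONEST DEPENDENCY (cell): continuum YM on T⁴ ⇐ BetaPertH ∧ nine spine estimates (0/9 proved); BetaPertH ⇐ (D1) ∧ (D4)
∧ CAP+tail.  This file changes none of it.
-/

open Finset
open Literature.MathematicalPhysics.QuantumFieldTheory.Balaban1983to89
open T4PersistenceDictionary T4PartnerMultiplicity
open Summit.QuantumFields.BalabanUV.T4Continuum.PlacementSkeleton
open Summit.QuantumFields.BalabanUV.T4Continuum.Crowding
open Summit.QuantumFields.BalabanUV.T4Continuum.ZoneSkeleton
open Summit.QuantumFields.BalabanUV.T4Continuum.ZoneCrowd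

namespace Summit.QuantumFields.BalabanUV.T4Continuum.ZoneTorus

noncomputable section

variable {ε ε' : Type*} [DecidableEq ε] [DecidableEq ε']

/-! ## §1 Formation time and the driver at the three constructors -/

omit [DecidableEq ε] in
/-- FORMATION TIME of a structure: the step of its last formation event (birth of a leaf, the merger of a merge node;
a renewal forms nothing). [folklore] -/
def ftime (st : ε → ℕ) : Gen ε → ℕ
  | Gen.born b _ => st b
  | Gen.renew G _ _ => ftime st G
  | Gen.merge _ _ e => st e

/-- the formation time is the step of a formation event [folklore] -/
theorem exists_form_ftime (st : ε → ℕ) : ∀ G : Gen ε, ∃ w ∈ form G, st w = ftime st G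
  | Gen.born b _ => ⟨b, by simp [form], rfl⟩
  | Gen.renew G _ _ => by
      obtain ⟨w, hw, h⟩ := exists_form_ftime st G
      exact ⟨w, by simpa [form, merges] using hw, h⟩
  | Gen.merge X Y e => ⟨e, by simp [form, merges], rfl⟩

/-- under chronology the partners of a merger are formed no later than the merger [folklore] -/
theorem ftime_le_of_chrono (st : ε → ℕ) {X Y : Gen ε} {e : ε} (h : Chrono st (Gen.merge X Y e)) :
    ftime st X ≤ st e ∧ ftime st Y ≤ st e := by
  obtain ⟨wX, hwX, hX⟩ := exists_form_ftime st X
  obtain ⟨wY, hwY, hY⟩ := exists_form_ftime st Y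
  exact ⟨hX ▸ h.2.2 wX (mem_union_left _ hwX), hY ▸ h.2.2 wY (mem_union_right _ hwY)⟩

/-- a renewal forms nothing: same driver [folklore] -/
theorem qZ_renew (wt : ε → ℝ) (σ : ℝ) (st : ε → ℕ) (G : Gen ε) (e : ε) (h t : ℕ) :
    qZ wt σ st (Gen.renew G e h) t = qZ wt σ st G t := by
  simp [qZ, form, merges]

/-- the driver of a leaf [folklore] -/
theorem qZ_born (wt : ε → ℝ) (σ : ℝ) (st : ε → ℕ) (b : ε) (j t : ℕ) :
    qZ wt σ st (Gen.born b j) t = wt b * σ ^ (2 * (t - st b)) := by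
  simp [qZ, form, merges]

/-- **EXACT ADDITIVITY AT A WELL-FORMED MERGER**: `qZ (merge X Y e) t = qZ X t + qZ Y t + wt e·σ^{2(t − st e)}`.
[folklore] -/
theorem qZ_merge_eq (W : ε → ℕ) (wt : ε → ℝ) (σ : ℝ) (st : ε → ℕ) {X Y : Gen ε} {e : ε}
    (hW : (Gen.merge X Y e).WF W) (t : ℕ) :
    qZ wt σ st (Gen.merge X Y e) t = qZ wt σ st X t + qZ wt σ st Y t + wt e * σ ^ (2 * (t - st e)) := by
  obtain ⟨heX, heY, -, -⟩ := merge_facts W hW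
  have heX' : e ∉ form X := fun h => hW.2.2.1 (form_subset_events X h)
  have heY' : e ∉ form Y := fun h => hW.2.2.2.1 (form_subset_events Y h)
  have hform : form (Gen.merge X Y e) = insert e (form X ∪ form Y) := by
    ext w; simp only [form, births_merge, merges, mem_union, mem_insert]; tauto
  have hnot : e ∉ form X ∪ form Y := by simp [heX', heY']
  unfold qZ
  rw [hform, sum_insert hnot, sum_union (disjoint_form W hW)]
  ring

/-- one step discounts the driver by at most `σ²` (`0 ≤ σ ≤ 1`, weights `≥ 0`): `σ²·qZ X t ≤ qZ X (t+1)`. [folklore] -/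
theorem sq_mul_qZ_le_succ (wt : ε → ℝ) (hwt : ∀ w, 0 ≤ wt w) {σ : ℝ} (h0 : 0 ≤ σ) (h1 : σ ≤ 1) (st : ε → ℕ)
    (X : Gen ε) (t : ℕ) : σ ^ 2 * qZ wt σ st X t ≤ qZ wt σ st X (t + 1) := by
  unfold qZ
  rw [mul_sum]
  refine sum_le_sum fun w _ => ?_
  rw [mul_left_comm]
  refine mul_le_mul_of_nonneg_left ?_ (hwt w)
  rcases Nat.lt_or_ge t (st w) with hlt | hge
  · have h1' : t - st w = 0 := by omega
    have h2' : t + 1 - st w = 0 := by omega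
    rw [h1', h2', mul_zero, pow_zero, mul_one]
    exact pow_le_one₀ h0 h1
  · have : 2 * (t + 1 - st w) = 2 * (t - st w) + 2 := by omega
    rw [this, pow_add, mul_comm]

/-! ## §2 The zone dynamics and the affine law -/

omit [DecidableEq ε] in
/-- **ZONE DYNAMICS** (elementary facts about the extents `ext t X` of structures at steps `t`): birth size, merger
subadditivity (+1 for touching), one-step contraction with rounding, renewals do not enlarge. [folklore] -/
structure ZoneDyn (st : ε → ℕ) (wt : ε → ℝ) (σ Cb : ℝ) (ext : ℕ → Gen ε → ℝ) : Prop where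
  /-- a new structure spans at most `Cb·wt b` at its formation step -/
  birth : ∀ (b : ε) (j : ℕ), ext (st b) (Gen.born b j) ≤ Cb * wt b
  /-- touching zones: the merged extent is at most the sum plus one -/
  merge : ∀ (X Y : Gen ε) (e : ε), ext (st e) (Gen.merge X Y e) ≤ ext (st e) X + ext (st e) Y + 1
  /-- one blocking step contracts a formed structure's extent by `σ²` up to rounding -/
  step : ∀ (X : Gen ε) (t : ℕ), ftime st X ≤ t → ext (t + 1) X ≤ σ ^ 2 * ext t X + 1
  /-- a renewal does not enlarge the zone -/
  renew : ∀ (G : Gen ε) (e : ε) (h t : ℕ), ext t (Gen.renew G e h) ≤ ext t G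

/-- **THE AFFINE CONTRACTION LAW FROM THE DYNAMICS.**  Under `ZoneDyn st wt σ Cb ext` with `0 ≤ σ < 1`, weights `≥ 1`,
and constants `Cb ≤ C₀`, `1∕(1−σ²) + 1 ≤ C₀`: every well-formed chronological structure satisfies, from its formation
time on, `ext t X ≤ C₀·qZ wt σ st X t + 1∕(1−σ²)`. [folklore] -/
theorem ext_le_affine (W : ε → ℕ) {st : ε → ℕ} {wt : ε → ℝ} (hwt : ∀ w, 1 ≤ wt w) {σ Cb C₀ : ℝ} (h0 : 0 ≤ σ)
    (h1 : σ < 1) {ext : ℕ → Gen ε → ℝ} (dyn : ZoneDyn st wt σ Cb ext) (hCb : Cb ≤ C₀)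
    (hC : 1 / (1 - σ ^ 2) + 1 ≤ C₀) :
    ∀ {X : Gen ε}, X.WF W → Chrono st X → ∀ t, ftime st X ≤ t → ext t X ≤ C₀ * qZ wt σ st X t + 1 / (1 - σ ^ 2) := by
  have hwt0 : ∀ w, 0 ≤ wt w := fun w => zero_le_one.trans (hwt w)
  have hs1 : σ ^ 2 < 1 := by nlinarith
  have hs0 : 0 ≤ σ ^ 2 := sq_nonneg σ
  have hc0 : 0 < 1 / (1 - σ ^ 2) := by positivity [sub_pos.2 hs1]
  have hC0 : 0 ≤ C₀ := by linarith
  set c₀ := 1 / (1 - σ ^ 2) with hc₀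
  -- the geometric-series step: `σ² c₀ + 1 = c₀`
  have hne : 1 - σ ^ 2 ≠ 0 := by linarith
  have hstep : σ ^ 2 * c₀ + 1 = c₀ := by
    rw [hc₀]; field_simp; ring
  -- propagation in time from a step `t₀` at which the law holds
  have prop : ∀ (X : Gen ε) (t₀ : ℕ), ftime st X ≤ t₀ → ext t₀ X ≤ C₀ * qZ wt σ st X t₀ + c₀ →
      ∀ t, t₀ ≤ t → ext t X ≤ C₀ * qZ wt σ st X t + c₀ := by
    intro X t₀ hft h0' t ht
    induction t, ht using Nat.le_induction with
    | base => exact h0'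
    | succ t ht ih =>
        have hq := sq_mul_qZ_le_succ wt hwt0 h0 h1.le st X t
        calc ext (t + 1) X ≤ σ ^ 2 * ext t X + 1 := dyn.step X t (hft.trans ht)
          _ ≤ σ ^ 2 * (C₀ * qZ wt σ st X t + c₀) + 1 := by nlinarith
          _ = C₀ * (σ ^ 2 * qZ wt σ st X t) + (σ ^ 2 * c₀ + 1) := by ring
          _ ≤ C₀ * qZ wt σ st X (t + 1) + c₀ := by rw [hstep]; nlinarith
  intro X hW hchr
  induction X with
  | born b j =>
      refine prop _ _ le_rfl ?_
      rw [ftime, qZ_born, Nat.sub_self, mul_zero, pow_zero, mul_one]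
      calc ext (st b) (Gen.born b j) ≤ Cb * wt b := dyn.birth b j
        _ ≤ C₀ * wt b + c₀ := by nlinarith [hwt0 b]
  | renew G e h ih =>
      intro t ht
      have := ih hW.1 hchr t ht
      rw [qZ_renew]
      exact (dyn.renew G e h t).trans this
  | merge X Y e ihX ihY =>
      obtain ⟨hfX, hfY⟩ := ftime_le_of_chrono st hchr
      have hX := ihX hW.1 hchr.1 (st e) hfX
      have hY := ihY hW.2.1 hchr.2.1 (st e) hfY
      refine prop _ _ le_rfl ?_
      rw [show ftime st (Gen.merge X Y e) = st e from rfl, qZ_merge_eq W wt σ st hW, Nat.sub_self, mul_zero,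
        pow_zero, mul_one]
      calc ext (st e) (Gen.merge X Y e) ≤ ext (st e) X + ext (st e) Y + 1 := dyn.merge X Y e
        _ ≤ C₀ * qZ wt σ st X (st e) + c₀ + (C₀ * qZ wt σ st Y (st e) + c₀) + 1 := by linarith
        _ ≤ C₀ * (qZ wt σ st X (st e) + qZ wt σ st Y (st e) + wt e) + c₀ := by nlinarith [hwt e]

/-! ## §3 The guarded extent: the law for all `t, X`; admissibility reads it identically -/

section Guard

open scoped Classical

/-- THE GUARDED EXTENT: the extent where the structure is well-formed, chronological and already formed; `0` elsewhere.
[folklore] -/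
def guardExt (W : ε → ℕ) (st : ε → ℕ) (ext : ℕ → Gen ε → ℝ) (t : ℕ) (X : Gen ε) : ℝ :=
  if X.WF W ∧ Chrono st X ∧ ftime st X ≤ t then ext t X else 0

/-- the guarded extent is nonnegative when the extent is [folklore] -/
theorem guardExt_nonneg (W : ε → ℕ) (st : ε → ℕ) {ext : ℕ → Gen ε → ℝ} (hext0 : ∀ t X, 0 ≤ ext t X) (t : ℕ)
    (X : Gen ε) : 0 ≤ guardExt W st ext t X := by
  unfold guardExt; split_ifs <;> simp [hext0]

/-- **THE AFFINE LAW FOR ALL `t, X`** (the displayed binder's shape) for the guarded extent. [folklore] -/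
theorem guardExt_le_affine (W : ε → ℕ) {st : ε → ℕ} {wt : ε → ℝ} (hwt : ∀ w, 1 ≤ wt w) {σ Cb C₀ : ℝ} (h0 : 0 ≤ σ)
    (h1 : σ < 1) {ext : ℕ → Gen ε → ℝ} (dyn : ZoneDyn st wt σ Cb ext) (hCb : Cb ≤ C₀)
    (hC : 1 / (1 - σ ^ 2) + 1 ≤ C₀) (t : ℕ) (X : Gen ε) :
    guardExt W st ext t X ≤ C₀ * qZ wt σ st X t + 1 / (1 - σ ^ 2) := by
  unfold guardExt
  split_ifs with h
  · exact ext_le_affine W hwt h0 h1 dyn hCb hC h.1 h.2.1 t h.2.2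
  · have hs1 : σ ^ 2 < 1 := by nlinarith
    have hq : 0 ≤ qZ wt σ st X t := sum_nonneg fun w _ => mul_nonneg (zero_le_one.trans (hwt w)) (pow_nonneg h0 _)
    have hd : 0 < 1 - σ ^ 2 := sub_pos.2 hs1
    have hc0 : 0 < 1 / (1 - σ ^ 2) := by positivity
    have hC0 : 0 ≤ C₀ := by linarith
    positivity

omit [DecidableEq ε] in
/-- **ADMISSIBILITY READS THE GUARDED EXTENT AS THE EXTENT** along `gmap f`: for `G : Gen ε` whose image is
well-formed and chronological, `AdmZ near (guardExt ∘ gmap f) (st' ∘ f) G P ↔ AdmZ near (ext ∘ gmap f) (st' ∘ f) G P`.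
[folklore] -/
theorem admZ_guard_gmap_iff {γ : Type*} (near : γ → ℕ → γ → ℕ → ℕ → ℝ → Prop) (W' : ε' → ℕ) (st' : ε' → ℕ)
    (ext : ℕ → Gen ε' → ℝ) (f : ε → ε') :
    ∀ {G : Gen ε}, (gmap f G).WF W' → Chrono st' (gmap f G) → ∀ P : ε → γ,
      (AdmZ near (fun t Z => guardExt W' st' ext t (gmap f Z)) (st' ∘ f) G P ↔
        AdmZ near (fun t Z => ext t (gmap f Z)) (st' ∘ f) G P)
  | Gen.born _ _, _, _, _ => Iff.rfl
  | Gen.renew G _ _, hW, hc, P => admZ_guard_gmap_iff near W' st' ext f (G := G) hW.1 hc P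
  | Gen.merge X Y e, hW, hc, P => by
      have hWX : (gmap f X).WF W' := hW.1
      have hWY : (gmap f Y).WF W' := hW.2.1
      have hcX : Chrono st' (gmap f X) := hc.1
      have hcY : Chrono st' (gmap f Y) := hc.2.1
      obtain ⟨hfX, hfY⟩ := ftime_le_of_chrono st' (X := gmap f X) (Y := gmap f Y) (e := f e) hc
      have gX : guardExt W' st' ext (st' (f e)) (gmap f X) = ext (st' (f e)) (gmap f X) := by
        simp [guardExt, hWX, hcX, hfX]
      have gY : guardExt W' st' ext (st' (f e)) (gmap f Y) = ext (st' (f e)) (gmap f Y) := by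
        simp [guardExt, hWY, hcY, hfY]
      simp only [AdmZ, Function.comp, admZ_guard_gmap_iff near W' st' ext f hWX hcX P,
        admZ_guard_gmap_iff near W' st' ext f hWY hcY P, gX, gY]

end Guard

/-! ## §4 On the torus: the `hlabZ` multiplicity factor from the zone dynamics -/

section Torus

variable {d : ℕ}

open scoped Classical

/-- **THE `hlabZ` MULTIPLICITY FACTOR ON THE TORUS FROM THE ZONE DYNAMICS.**  `card_admZSet_grestrict_le` with the
affine contraction law REPLACED by `ZoneDyn PEv.step wtPEv σ Cb ext` (+ `ext ≥ 0`, `0 ≤ σ < 1`): for `G : Gen PEv`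
well-formed, chronological, kind-`0` births ∕ non-kind-`0` mergers, events in `E`,
`#admZSet (nearT n L K) (ext ∘ gmap val) (step ∘ val) (grestrict E G hE) root c c₀'`
`  ≤ Kz ^ #merges G · (∏_{e ∈ merges G} Q(wcnt G, σ, step e)^(d:ℝ)) · (L^d) ^ partnerAges step G`,
`Kz = 2^d·(C₀ + 2∕(1−σ²) + 1)^d`, `C₀ = max Cb (1∕(1−σ²) + 1)`. [folklore] -/
theorem card_admZSet_grestrict_le_of_dyn (W : PEv → ℕ) (n : ℕ) {L : ℕ} (hL : 1 ≤ L) (K : ℕ)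
    (ext : ℕ → Gen PEv → ℝ) (hext0 : ∀ t X, 0 ≤ ext t X) {σ Cb : ℝ} (h0 : 0 ≤ σ) (h1 : σ < 1)
    (dyn : ZoneDyn PEv.step wtPEv σ Cb ext)
    {G : Gen PEv} (hW : G.WF W) (hchr : Chrono PEv.step G)
    (hk0 : ∀ b ∈ births G, b.kind = 0) (hk2 : ∀ m ∈ merges G, m.kind ≠ 0)
    (E : Finset PEv) (hE : G.events ⊆ E) (c c₀' : TCell d (n * L ^ K)) :
    ((admZSet (nearT n L K) (fun t Z => ext t (gmap Subtype.val Z)) (PEv.step ∘ Subtype.val)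
        (grestrict E G hE) (grestrict E G hE).root c c₀').card : ℝ) ≤
      ((2 : ℝ) ^ d * (max Cb (1 / (1 - σ ^ 2) + 1) + 2 * (1 / (1 - σ ^ 2)) + 1) ^ d) ^ (merges G).card *
        (∏ e ∈ merges G, Q (wcnt G) σ e.step ^ (d : ℝ)) * ((L : ℝ) ^ d) ^ partnerAges PEv.step G := by
  have hs1 : σ ^ 2 < 1 := by nlinarith
  have hc0 : 0 < 1 / (1 - σ ^ 2) := by have := sub_pos.2 hs1; positivity
  set C₀ := max Cb (1 / (1 - σ ^ 2) + 1) with hC₀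
  have hC : 0 ≤ C₀ := le_max_of_le_right (by linarith)
  have hlaw := guardExt_le_affine W one_le_wtPEv h0 h1 dyn (le_max_left _ _) (le_max_right _ _)
  have hGG : gmap Subtype.val (grestrict E G hE) = G := gmap_grestrict E G hE
  -- admissibility reads the guarded extent as the extent
  have hset : admZSet (nearT n L K) (fun t Z => ext t (gmap Subtype.val Z)) (PEv.step ∘ Subtype.val)
        (grestrict E G hE) (grestrict E G hE).root c c₀' =
      admZSet (nearT n L K) (fun t Z => guardExt W PEv.step ext t (gmap Subtype.val Z)) (PEv.step ∘ Subtype.val)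
        (grestrict E G hE) (grestrict E G hE).root c c₀' := by
    unfold admZSet
    refine filter_congr fun P _ => ?_
    rw [admZ_guard_gmap_iff (nearT n L K) W PEv.step ext Subtype.val (by rw [hGG]; exact hW)
      (by rw [hGG]; exact hchr) P]
  rw [hset]
  exact card_admZSet_grestrict_le W n hL K (guardExt W PEv.step ext) (guardExt_nonneg W PEv.step hext0) hC
    hc0.le h0 hlaw hW hchr hk0 hk2 E hE c c₀'

end Torus

/-! ## §5 Sanity -/

namespace Sanity

/-- the model extent `E_t = 2·(1∕4)^{t} + 4∕3` of a single leaf (`σ² = 1∕4`, `Cb = 2`, weight `1`, born at `0`)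
obeys the dynamics' step with equality up to the rounding slack: `E_{t+1} = E_t∕4 + 1` -/
theorem leaf_model (t : ℕ) :
    (2 : ℝ) * (1 / 4) ^ (t + 1) + 4 / 3 = (1 / 4) * (2 * (1 / 4) ^ t + 4 / 3) + 1 := by
  rw [pow_succ]; ring

/-- the constants at `σ² = 1∕L = 1∕13`, `Cb = 3`: `c₀ = 13∕12`, `C₀ = max 3 (25∕12) = 3` -/
theorem constants_example : max (3 : ℝ) (1 / (1 - (1 / Real.sqrt 13) ^ 2) + 1) = 3 := by
  have h : (1 / Real.sqrt 13) ^ 2 = (1 : ℝ) / 13 := by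
    rw [div_pow, one_pow, Real.sq_sqrt (by norm_num)]
  rw [h]; norm_num

end Sanity

end

end Summit.QuantumFields.BalabanUV.T4Continuum.ZoneTorus
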